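import Summits.ResolutionOfSingularities.ResolutionOfSingularities.Theorems.HilbertSamuelEliminationSigmaMaxModificationsCorridor3TameWildNuGluing2
import Mathlib.Order.CompleteLattice.Finset
import HarnessLib

/-!
# Route `HilbertSamuelElimination`, crux `SigmaMaxModificationsCorridor3`
# (stmt-ResolutionOfSingularities-19249; child of `SigmaMaxModifications` stmt-…-18506),
# line `tame_wild`: the `ν`-gluing for FINITELY MANY charts with pairwise disjoint traces

[OURS · L1 W4.2] The finite-family form of helper G2 (`L/w42/CHAIN.md` v2 §4 "then the
finite-family version by induction"; lead-1's RESHAPE v3, `stub_confinedTameNu3_of_thor4`: "glue the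
finitely many witnesses with disjoint traces (ν-gluing, p459350 pattern)"). Given local
`ν`-witnesses `ρ_i : Y_i → U_i` over finitely many opens `U_i` (`i ∈ s`, `s` non-empty) whose
pairwise intersections lie in `Zc` (the charts meet only off the stratum), the shape-preserving
two-chart merge `exists_localWitness_sup` (`…Corridor3TameWildNuGluing2.lean`) iterates along
`Finset.cons` to ONE local witness over `⋃_{i ∈ s} U_i` (`exists_localWitness_biSup`); if moreover
`Zc = X ∖ X(ν)` and `Zc ∪ ⋃ U_i = X`, the landed one-chart gluing `TameWild.nuMod_of_localWitness`
(p459350) gives `NuMod X N d ν` (`nuMod_of_localWitnesses`). NOT a statement of any manuscript.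

## Sources

* The Stacks Project, Tags 01JA, 01LH (gluing of schemes). [StacksProject]
* V. Cossart, U. Jannsen, S. Saito, LNM 2270 (2020), Def. 6.14, Rem. 6.24.
  [CossartJannsenSaito2020]
-/

set_option linter.dupNamespace false -- mandated namespace of this single-conjunct summit

noncomputable section

open CategoryTheory CategoryTheory.Limits AlgebraicGeometry TopologicalSpace Topology
open Literature.AlgebraicGeometry.Resolution Literature.RingTheory.HilbertSamuel
open Summit.ResolutionOfSingularities.ResolutionOfSingularities.Theorems.SigmaMaxModificationsCorridor3.TameWild

namespace Summit.ResolutionOfSingularities.ResolutionOfSingularities.Theorems.SigmaMaxModificationsCorridor3.Helpers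

universe u v

/-- **Finitely many local `ν`-witnesses with pairwise disjoint traces merge into one.** Let `X`
be locally Noetherian, `Zc ⊆ X` open, `U : ι → Opens X`, `s` a non-empty finite set of indices with
`U i ∩ U j ⊆ Zc` for `i ≠ j` in `s`, and for every `i ∈ s` a local witness `ρ_i : Y_i → U_i`
(proper, `Y_i` reduced of dimension `≤ d` and `≤ N`, an isomorphism over `U_i ∩ Zc`, dense opens of
`X` inside `X ∖ X(ν)` pulled back to dense opens, `H^N` non-increasing, `ν ∉ Σ_{Y_i}(N)`). Then there
is one local witness of the same shape over `⋃_{i ∈ s} U_i` (induction along `Finset.cons` with the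
two-chart merge `exists_localWitness_sup`). [OURS · L1 W4.2] finite ν-gluing; NOT a statement of the
manuscript. [cite: StacksProject, Tag 01LH] [cite: CossartJannsenSaito2020, Def. 6.14, Rem. 6.24] -/
theorem exists_localWitness_biSup (X : Scheme.{u}) [IsLocallyNoetherian X] (N d : ℕ) (ν : ℕ → ℕ)
    (Zc : X.Opens) {ι : Type v} (U : ι → X.Opens) {s : Finset ι} (hs : s.Nonempty)
    (hdisj : ∀ i ∈ s, ∀ j ∈ s, i ≠ j → U i ⊓ U j ≤ Zc)
    (hw : ∀ i ∈ s, ∃ (Y : Scheme.{u}) (ρ : Y ⟶ (U i : Scheme.{u})), IsProper ρ ∧ IsReduced Y ∧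
      topologicalKrullDim Y ≤ (d : WithBot ℕ∞) ∧ topologicalKrullDim Y ≤ (N : WithBot ℕ∞) ∧
      IsIso (ρ ∣_ ((U i).ι ⁻¹ᵁ Zc)) ∧
      (∀ V : X.Opens, Dense (V : Set X) → (V : Set X) ⊆ (Scheme.hsStratum X N ν)ᶜ →
        Dense ((ρ ⁻¹ᵁ ((U i).ι ⁻¹ᵁ V) : Y.Opens) : Set Y)) ∧
      (∀ y : Y, Scheme.hsFun Y N y ≤ Scheme.hsFun X N ((U i).ι.base (ρ.base y))) ∧
      ν ∉ Scheme.hsValues Y N) :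
    ∃ (Y : Scheme.{u}) (ρ : Y ⟶ (↑(⨆ i ∈ s, U i) : Scheme.{u})), IsProper ρ ∧ IsReduced Y ∧
      topologicalKrullDim Y ≤ (d : WithBot ℕ∞) ∧ topologicalKrullDim Y ≤ (N : WithBot ℕ∞) ∧
      IsIso (ρ ∣_ ((⨆ i ∈ s, U i).ι ⁻¹ᵁ Zc)) ∧
      (∀ V : X.Opens, Dense (V : Set X) → (V : Set X) ⊆ (Scheme.hsStratum X N ν)ᶜ →
        Dense ((ρ ⁻¹ᵁ ((⨆ i ∈ s, U i).ι ⁻¹ᵁ V) : Y.Opens) : Set Y)) ∧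
      (∀ y : Y, Scheme.hsFun Y N y ≤ Scheme.hsFun X N ((⨆ i ∈ s, U i).ι.base (ρ.base y))) ∧
      ν ∉ Scheme.hsValues Y N := by
  classical
  induction hs using Finset.Nonempty.cons_induction with
  | singleton a =>
    have he : (⨆ i ∈ ({a} : Finset ι), U i) = U a := Finset.iSup_singleton a U
    rw [he]
    exact hw a (Finset.mem_singleton_self a)
  | cons a t ha ht ih =>
    have he : (⨆ i ∈ Finset.cons a t ha, U i) = U a ⊔ ⨆ i ∈ t, U i := by
      rw [Finset.cons_eq_insert, Finset.iSup_insert]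
    -- the witness over `U a` and the merged witness over `⋃_{i ∈ t} U i`
    obtain ⟨Y₁, ρ₁, hρ₁, hY₁, hd₁, hN₁, hiso₁, hdense₁, hmono₁, hkill₁⟩ :=
      hw a (Finset.mem_cons_self a t)
    obtain ⟨Y₂, ρ₂, hρ₂, hY₂, hd₂, hN₂, hiso₂, hdense₂, hmono₂, hkill₂⟩ :=
      ih (fun i hi j hj hij => hdisj i (Finset.mem_cons_of_mem hi) j (Finset.mem_cons_of_mem hj) hij)
        (fun i hi => hw i (Finset.mem_cons_of_mem hi))
    haveI := hρ₁
    haveI := hY₁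
    haveI := hρ₂
    haveI := hY₂
    -- the charts meet only inside `Zc`
    have h12 : U a ⊓ (⨆ i ∈ t, U i) ≤ Zc := by
      rw [inf_iSup₂_eq]
      exact iSup₂_le fun i hi => hdisj a (Finset.mem_cons_self a t) i (Finset.mem_cons_of_mem hi)
        (fun h => ha (h ▸ hi))
    rw [he]
    exact exists_localWitness_sup X N d ν Zc (U a) (⨆ i ∈ t, U i) h12 Y₁ ρ₁ hd₁ hN₁ hiso₁ hdense₁
      hmono₁ hkill₁ Y₂ ρ₂ hd₂ hN₂ hiso₂ hdense₂ hmono₂ hkill₂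

/-- **The `ν`-gluing for finitely many charts with pairwise disjoint traces.** On a reduced
locally Noetherian `X` of dimension `≤ d` and `≤ N`, with `Zc = X ∖ X(ν)` open: local `ν`-witnesses
over finitely many opens `U_i` (`i ∈ s ≠ ∅`) which together with `Zc` cover `X` and which pairwise
meet only inside `Zc` glue, with the identity off the stratum, to a `ν`-modification `NuMod X N d ν`
(`exists_localWitness_biSup` + the landed `TameWild.nuMod_of_localWitness`, p459350). This is the
gluing step of `stub_confinedTameNu3_of_thor4` (tame_wild v3): after confinement the stratum lies
over finitely many closed points `y_1, …, y_r`, and charts `U_i ∋ y_i` with `y_j ∉ U_i` (`j ≠ i`)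
have pairwise disjoint traces. [OURS · L1 W4.2] finite ν-gluing; NOT a statement of the manuscript.
[cite: CossartJannsenSaito2020, Def. 6.14, Rem. 6.24] [cite: StacksProject, Tag 01LH] -/
theorem nuMod_of_localWitnesses (X : Scheme.{0}) [IsLocallyNoetherian X] [IsReduced X] (N d : ℕ)
    (ν : ℕ → ℕ) (hdimXd : topologicalKrullDim X ≤ (d : WithBot ℕ∞))
    (hdimX : topologicalKrullDim X ≤ (N : WithBot ℕ∞)) (Zc : X.Opens) {ι : Type v}
    (U : ι → X.Opens) {s : Finset ι} (hs : s.Nonempty)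
    (hZc : (Zc : Set X) = (Scheme.hsStratum X N ν)ᶜ) (hcov : Zc ⊔ (⨆ i ∈ s, U i) = ⊤)
    (hdisj : ∀ i ∈ s, ∀ j ∈ s, i ≠ j → U i ⊓ U j ≤ Zc)
    (hw : ∀ i ∈ s, ∃ (Y : Scheme.{0}) (ρ : Y ⟶ (U i : Scheme.{0})), IsProper ρ ∧ IsReduced Y ∧
      topologicalKrullDim Y ≤ (d : WithBot ℕ∞) ∧ topologicalKrullDim Y ≤ (N : WithBot ℕ∞) ∧
      IsIso (ρ ∣_ ((U i).ι ⁻¹ᵁ Zc)) ∧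
      (∀ V : X.Opens, Dense (V : Set X) → (V : Set X) ⊆ (Scheme.hsStratum X N ν)ᶜ →
        Dense ((ρ ⁻¹ᵁ ((U i).ι ⁻¹ᵁ V) : Y.Opens) : Set Y)) ∧
      (∀ y : Y, Scheme.hsFun Y N y ≤ Scheme.hsFun X N ((U i).ι.base (ρ.base y))) ∧
      ν ∉ Scheme.hsValues Y N) :
    NuMod X N d ν := by
  obtain ⟨Y, ρ, hρ, hred, hd, hN, hiso, hdense, hmono, hkill⟩ :=
    exists_localWitness_biSup X N d ν Zc U hs hdisj hw
  exact nuMod_of_localWitness X N d ν hdimXd hdimX Zc (⨆ i ∈ s, U i) hZc hcov Y ρ hρ hred hd hN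
    hiso hdense hmono hkill

/-- **The empty case: a value with empty stratum needs no modification.** If `X(ν) = ∅` on a
reduced locally Noetherian `X` of dimension `≤ d` and `≤ N`, the identity is a `ν`-modification.
[cite: CossartJannsenSaito2020, Def. 6.14] -/
theorem nuMod_of_hsStratum_eq_empty (X : Scheme.{0}) [IsReduced X] (N d : ℕ) (ν : ℕ → ℕ)
    (hdimXd : topologicalKrullDim X ≤ (d : WithBot ℕ∞))
    (hdimX : topologicalKrullDim X ≤ (N : WithBot ℕ∞)) (h : Scheme.hsStratum X N ν = ∅) :
    NuMod X N d ν := by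
  refine ⟨X, 𝟙 X, inferInstance, inferInstance, hdimXd, hdimX, fun U _ => ?_, fun U hU _ => ?_,
    fun x => le_of_eq ?_, ?_⟩
  · infer_instance
  · simpa using hU
  · rfl
  · rintro ⟨x, hx⟩
    have : x ∈ Scheme.hsStratum X N ν := hx
    rw [h] at this
    exact this

end Summit.ResolutionOfSingularities.ResolutionOfSingularities.Theorems.SigmaMaxModificationsCorridor3.Helpers

end
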